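import Summits.CriticalPhenomena.Ising3DConformalLimit.Theses.FKParityRobustness
import Summits.CriticalPhenomena.Ising3DConformalLimit.Theorems.FKParityRobustnessIndependentStrandsJoinLimitUpgrade
import Summits.CriticalPhenomena.Ising3DConformalLimit.Theorems.FKParityRobustnessIndependentStrandsJoinRectTransfer
import Summits.CriticalPhenomena.Ising3DConformalLimit.Theorems.FKParityRobustnessIndependentStrandsJoinStubPerScale
import Summits.CriticalPhenomena.Ising3DConformalLimit.Theorems.FKParityRobustnessIndependentStrandsJoinShapeResidual
import HarnessLib

/-!
# `IndependentStrandsJoin` ⟺ `TetraMergingEventually` — the LIMIT-FREE upgrade (crux stmt-CriticalPhenomena-14625,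
# route `FKParityRobustness`, line `pinch-to-tetra` r7; lead `prover-line-stmt-CriticalPhenomena-14625-c7-0`, 2026-08-17)

Theorem-only file (`--supports stmt-CriticalPhenomena-14625`).  The landed composition
`independentStrandsJoin_of_limit_io : LimitExists → TetraMergingIO → IndependentStrandsJoinPerScale → IndependentStrandsJoin`
(`…LimitUpgrade.lean`) uses the existence of the scaling limit (`LimitExists`, items 1344/4738) for ONE step only: the
upgrade `∃^∞ l ⟹ ∀ large l` (`tetraMergingEventually_of_io`).  Everything downstream — the passage from the critical state to
large free boxes (`boxU4Bound_of_critical`), the per-box tetrahedral sandwich (`jointSum_ge_of_boxU4`), and the finite minimum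
with the per-scale constants — is limit-free, and the per-scale crux is LANDED (`Theorems.stub_perScale`).  Hence:

* `independentStrandsJoin_of_eventually : TetraMergingEventually → IndependentStrandsJoinPerScale → IndependentStrandsJoin`
  (the landed proof with its first line removed);
* (landed, `…ShapeResidual.lean`) `tetraMergingEventually_of_independentStrandsJoin : IndependentStrandsJoin →
  TetraMergingEventually` (closed sandwich of line `Sketch`, at every scale `l ≥ 1`);
* `independentStrandsJoin_iff_tetraMergingEventually : IndependentStrandsJoin ↔ TetraMergingEventually` — UNCONDITIONAL
  (no limit, no covariance): the crux IS far merging of the critical Ursell function at the regular tetrahedra at all large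
  scales, i.e. (`independentStrandsJoin_iff_R4ratio`) `∃ c > 0, ∀ large l, c ≤ R₄(A_l)` — lattice hyperscaling at ONE shape
  (Aizenman 1982's dimensionless renormalised coupling restricted to the tetrahedra; `d = 2` proved [AizenmanCMP1982],
  `d = 4` refuted [AizenmanDuminilCopinAnnals2021], `d = 3` open [DuminilCopinICM2022, §6.4]);
* `independentStrandsJoin_iff_strictLebowitzTetra` — the same in four-point form: `∃ c > 0, ∀ large l,
  ⟨σσσσ⟩_{β_c}(l·tetra) ≤ (3 − c)·τ_d(l)²` (all six pair distances of `l·tetra` equal `2√2·l`, so the Wick sum is `3τ_d²`);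
* `independentStrandsJoin_of_rectDominance : RectDominance → IndependentStrandsJoin` — UNCONDITIONAL (r6 needed
  `LimitExists` only through the detour `Eventually → IO → Eventually`): with the landed reflection-positivity transfer
  `S₄(l·tetra) ≤ S₄(l·rect)` (`tetraMergingEventually_of_rectDominance`), the quantitative RP-diagonal floor ALONE gives
  the crux; re-exported as the registered sub-goal `Theorems.stub_eventuallyUpgrade`.

Upshot for the skeleton: r7 := {stub_rectDominance}; `stub_limitExists` leaves the crux.  Nothing here claims
`TetraMergingEventually` or `RectDominance`.

References: M. Aizenman, Comm. Math. Phys. 86 (1982) §5, Prop. 5.3 [AizenmanCMP1982]; M. Aizenman, H. Duminil-Copin,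
Ann. of Math. 194 (2021) [AizenmanDuminilCopinAnnals2021]; H. Duminil-Copin, ICM 2022 survey §6.4 [DuminilCopinICM2022].
-/

noncomputable section

open Filter Topology Finset
open Literature.Probability.LatticeModels
open Summit.CriticalPhenomena.Ising3DConformalLimit.Theses.FKParityRobustness
open Summit.CriticalPhenomena.Ising3DConformalLimit.Cruxes.ParityRobustMerging.PlaquetteXorSurgery
  (tetra tanh_criticalBeta_nonneg)

namespace Summit.CriticalPhenomena.Ising3DConformalLimit.Cruxes.IndependentStrandsJoin.PinchToTetra

/-! ## The limit-free composition -/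

/-- **Limit-free upgrade.**  Tetrahedral far merging at all large scales (`TetraMergingEventually`) and the per-scale crux
(`IndependentStrandsJoinPerScale`, landed as `Theorems.stub_perScale`) imply the crux BY NAME: the infinite-volume bound at
scales `l ≥ l₁` passes to large free boxes (`boxU4Bound_of_critical`) and, per box, to the joint loop-O(1) sum with constant
`c/6` (`jointSum_ge_of_boxU4`); the finitely many scales `1 ≤ l < l₁` carry their own positive constants; the crux's constant is
the finite minimum.  No scaling limit is used. [folklore] -/
theorem independentStrandsJoin_of_eventually :
    TetraMergingEventually → IndependentStrandsJoinPerScale →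
      Summit.CriticalPhenomena.Ising3DConformalLimit.Theses.FKParityRobustness.IndependentStrandsJoin := by
  intro hev0 hper
  obtain ⟨c, hc, l₁, hev⟩ := hev0
  -- per-scale constants below `l₁`
  have hper' : ∀ l : ℕ, 1 ≤ l → ∃ c' : ℝ, 0 < c' ∧ ∃ N₀ : ℕ, ∀ N : ℕ, N₀ ≤ N → ∀ a : Fin 4 → ↥(box 3 N),
      (∀ i, ((a i : Site 3)) = (l : ℤ) • tetra i) →
      c' * loopO1PartitionFunction ((zdGraph 3).comap (Subtype.val : ↥(box 3 N) → Site 3))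
          (Real.tanh (criticalBeta 3)) {a 0, a 1} *
        loopO1PartitionFunction ((zdGraph 3).comap (Subtype.val : ↥(box 3 N) → Site 3))
          (Real.tanh (criticalBeta 3)) {a 2, a 3} ≤
        ∑ F₁ ∈ tJoins ((zdGraph 3).comap (Subtype.val : ↥(box 3 N) → Site 3)) Set.univ {a 0, a 1},
          ∑ F₂ ∈ tJoins ((zdGraph 3).comap (Subtype.val : ↥(box 3 N) → Site 3)) Set.univ {a 2, a 3},
            if (SimpleGraph.fromEdgeSet ((↑F₁ : Set (Sym2 ↥(box 3 N))) ∪ ↑F₂)).Reachable (a 0) (a 2)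
            then Real.tanh (criticalBeta 3) ^ (F₁.card + F₂.card) else 0 := hper
  -- large scales: constant `c/2/3`
  have hlarge : ∀ l : ℕ, 1 ≤ l → l₁ ≤ l → ∃ N₀ : ℕ, ∀ N : ℕ, N₀ ≤ N → ∀ a : Fin 4 → ↥(box 3 N),
      (∀ i, ((a i : Site 3)) = (l : ℤ) • tetra i) →
      c / 2 / 3 * loopO1PartitionFunction ((zdGraph 3).comap (Subtype.val : ↥(box 3 N) → Site 3))
          (Real.tanh (criticalBeta 3)) {a 0, a 1} *
        loopO1PartitionFunction ((zdGraph 3).comap (Subtype.val : ↥(box 3 N) → Site 3))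
          (Real.tanh (criticalBeta 3)) {a 2, a 3} ≤
        ∑ F₁ ∈ tJoins ((zdGraph 3).comap (Subtype.val : ↥(box 3 N) → Site 3)) Set.univ {a 0, a 1},
          ∑ F₂ ∈ tJoins ((zdGraph 3).comap (Subtype.val : ↥(box 3 N) → Site 3)) Set.univ {a 2, a 3},
            if (SimpleGraph.fromEdgeSet ((↑F₁ : Set (Sym2 ↥(box 3 N))) ∪ ↑F₂)).Reachable (a 0) (a 2)
            then Real.tanh (criticalBeta 3) ^ (F₁.card + F₂.card) else 0 := by
    intro l hl hl₁
    obtain ⟨N₀, hN₀⟩ := boxU4Bound_of_critical hc hl (hev l hl₁)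
    exact ⟨N₀, fun N hN a ha => jointSum_ge_of_boxU4 hl a ha (hN₀ N hN a ha)⟩
  -- a non-dependent choice of per-scale constants (value `1` at the unused scale `l = 0`)
  have hper'' : ∀ l : ℕ, ∃ c' : ℝ, 0 < c' ∧ (1 ≤ l → ∃ N₀ : ℕ, ∀ N : ℕ, N₀ ≤ N → ∀ a : Fin 4 → ↥(box 3 N),
      (∀ i, ((a i : Site 3)) = (l : ℤ) • tetra i) →
      c' * loopO1PartitionFunction ((zdGraph 3).comap (Subtype.val : ↥(box 3 N) → Site 3))
          (Real.tanh (criticalBeta 3)) {a 0, a 1} *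
        loopO1PartitionFunction ((zdGraph 3).comap (Subtype.val : ↥(box 3 N) → Site 3))
          (Real.tanh (criticalBeta 3)) {a 2, a 3} ≤
        ∑ F₁ ∈ tJoins ((zdGraph 3).comap (Subtype.val : ↥(box 3 N) → Site 3)) Set.univ {a 0, a 1},
          ∑ F₂ ∈ tJoins ((zdGraph 3).comap (Subtype.val : ↥(box 3 N) → Site 3)) Set.univ {a 2, a 3},
            if (SimpleGraph.fromEdgeSet ((↑F₁ : Set (Sym2 ↥(box 3 N))) ∪ ↑F₂)).Reachable (a 0) (a 2)
            then Real.tanh (criticalBeta 3) ^ (F₁.card + F₂.card) else 0) := by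
    intro l
    by_cases hl : 1 ≤ l
    · obtain ⟨c', hc', h⟩ := hper' l hl
      exact ⟨c', hc', fun _ => h⟩
    · exact ⟨1, one_pos, fun h => absurd h hl⟩
  choose cf hcf hN using hper''
  -- the crux's constant: the minimum of `c/6` and the per-scale constants at the scales `l ≤ l₁`
  have hne : (Finset.range (l₁ + 1)).Nonempty := ⟨0, by simp⟩
  set cstar : ℝ := min (c / 2 / 3) ((Finset.range (l₁ + 1)).inf' hne cf) with hcstar
  have hcstar_pos : 0 < cstar := by
    refine lt_min (by positivity) ?_
    exact (Finset.lt_inf'_iff hne).2 fun l _ => hcf l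
  have hcstar_le : cstar ≤ c / 2 / 3 := min_le_left _ _
  have hcstar_le' : ∀ l : ℕ, l ≤ l₁ → cstar ≤ cf l := fun l hl =>
    (min_le_right _ _).trans (Finset.inf'_le cf (by simpa [Nat.lt_succ_iff] using hl))
  refine ⟨cstar, hcstar_pos, fun l hl => ?_⟩
  have ht : 0 ≤ Real.tanh (criticalBeta 3) := tanh_criticalBeta_nonneg
  by_cases hl₁ : l₁ ≤ l
  · obtain ⟨N₀, hN₀⟩ := hlarge l hl hl₁
    refine ⟨N₀, fun N hNN a ha => ?_⟩
    have h := hN₀ N hNN a ha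
    have hZ : 0 ≤ loopO1PartitionFunction ((zdGraph 3).comap (Subtype.val : ↥(box 3 N) → Site 3))
          (Real.tanh (criticalBeta 3)) {a 0, a 1} *
        loopO1PartitionFunction ((zdGraph 3).comap (Subtype.val : ↥(box 3 N) → Site 3))
          (Real.tanh (criticalBeta 3)) {a 2, a 3} :=
      mul_nonneg (loopO1PartitionFunction_nonneg _ ht _) (loopO1PartitionFunction_nonneg _ ht _)
    have hmono := mul_le_mul_of_nonneg_right hcstar_le hZ
    simp only
    linarith [hmono, h]
  · push Not at hl₁
    obtain ⟨N₀, hN₀⟩ := hN l hl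
    refine ⟨N₀, fun N hNN a ha => ?_⟩
    have h := hN₀ N hNN a ha
    have hZ : 0 ≤ loopO1PartitionFunction ((zdGraph 3).comap (Subtype.val : ↥(box 3 N) → Site 3))
          (Real.tanh (criticalBeta 3)) {a 0, a 1} *
        loopO1PartitionFunction ((zdGraph 3).comap (Subtype.val : ↥(box 3 N) → Site 3))
          (Real.tanh (criticalBeta 3)) {a 2, a 3} :=
      mul_nonneg (loopO1PartitionFunction_nonneg _ ht _) (loopO1PartitionFunction_nonneg _ ht _)
    have hmono := mul_le_mul_of_nonneg_right (hcstar_le' l hl₁.le) hZ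
    simp only
    linarith [hmono, h]

/-- **The crux IS tetrahedral far merging at all large scales — unconditionally.**  `IndependentStrandsJoin ↔
TetraMergingEventually` (the per-scale crux `Theorems.stub_perScale` is landed; no scaling limit, no covariance). [folklore] -/
theorem independentStrandsJoin_iff_tetraMergingEventually : IndependentStrandsJoin ↔ TetraMergingEventually :=
  ⟨tetraMergingEventually_of_independentStrandsJoin, fun h =>
    independentStrandsJoin_of_eventually h Summit.CriticalPhenomena.Ising3DConformalLimit.Theorems.stub_perScale⟩

/-- **The crux IS lattice hyperscaling at the regular tetrahedron**: `IndependentStrandsJoin ↔ ∃ c > 0, ∀ large l,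
c ≤ R₄(A_l)`, `R₄(A_l) = −U₄crit(l·tetra)/(⟨σσ⟩⟨σσ⟩) ∈ [0, 2]` Aizenman's merging ratio (twice the probability that the two
sourced critical double currents of the tetrahedron intersect). [folklore] -/
theorem independentStrandsJoin_iff_R4ratio :
    IndependentStrandsJoin ↔ ∃ c : ℝ, 0 < c ∧ ∃ l₁ : ℕ, ∀ l : ℕ, l₁ ≤ l → c ≤ R4ratio l := by
  rw [independentStrandsJoin_iff_tetraMergingEventually]
  constructor
  · rintro ⟨c, hc, l₁, h⟩
    refine ⟨c, hc, l₁, fun l hl => ?_⟩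
    have hG := GGcrit_pos l
    rw [R4ratio, le_div_iff₀ hG]
    linarith [h l hl]
  · rintro ⟨c, hc, l₁, h⟩
    refine ⟨c, hc, l₁, fun l hl => ?_⟩
    have hG := GGcrit_pos l
    have := h l hl
    rw [R4ratio, le_div_iff₀ hG] at this
    linarith

/-- The same as an `atTop`-eventually statement: `IndependentStrandsJoin ↔ ∃ c > 0, ∀ᶠ l in atTop, c ≤ R₄(A_l)`. [folklore] -/
theorem independentStrandsJoin_iff_eventually_R4ratio :
    IndependentStrandsJoin ↔ ∃ c : ℝ, 0 < c ∧ ∀ᶠ l : ℕ in atTop, c ≤ R4ratio l := by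
  rw [independentStrandsJoin_iff_R4ratio]
  simp only [Filter.eventually_atTop]

/-- **Strict Lebowitz at the tetrahedron, uniformly in the scale**: `IndependentStrandsJoin ↔ ∃ c > 0, ∀ large l,
⟨σσσσ⟩_{β_c}(l·tetra) ≤ (3 − c)·⟨σσ⟩⟨σσ⟩` (the Wick sum at the regular tetrahedron is `3·GG`, `wick_tetra_eq`). [folklore] -/
theorem independentStrandsJoin_iff_strictLebowitzTetra :
    IndependentStrandsJoin ↔ ∃ c : ℝ, 0 < c ∧ ∃ l₁ : ℕ, ∀ l : ℕ, l₁ ≤ l →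
      criticalCorr 3 4 (fun i => (l : ℤ) • tetra i) ≤ (3 - c) * GGcrit l := by
  rw [independentStrandsJoin_iff_tetraMergingEventually]
  constructor
  · rintro ⟨c, hc, l₁, h⟩
    exact ⟨c, hc, l₁, fun l hl => criticalCorr_tetra_le_of_tetraMerging (h l hl)⟩
  · rintro ⟨c, hc, l₁, h⟩
    refine ⟨c, hc, l₁, fun l hl => ?_⟩
    have hw := wick_tetra_eq l
    have h1 := h l hl
    unfold U4crit
    linarith

/-- **RectDominance ⟹ the crux, unconditionally.**  If for some `c > 0` and all large `l` the critical four-point function at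
the RP-diagonal `2l × 2√2·l` rectangle `l·((−1,−1,−1),(1,1,−1),(−1,−1,1),(1,1,1))` is at most `(3 − c)·⟨σσ⟩⟨σσ⟩(l·tetra)`, then
`IndependentStrandsJoin` holds: reflection-positivity transfer to the tetrahedron (`tetraMergingEventually_of_rectDominance`),
then the limit-free upgrade.  (Skeleton r6 routed this through `LimitExists`; the limit is not needed.) [folklore] -/
theorem independentStrandsJoin_of_rectDominance
    (h : ∃ c : ℝ, 0 < c ∧ ∃ l₁ : ℕ, ∀ l : ℕ, l₁ ≤ l →
      criticalCorr 3 4 (fun i => (l : ℤ) •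
          (![![-1, -1, -1], ![1, 1, -1], ![-1, -1, 1], ![1, 1, 1]] : Fin 4 → Site 3) i) ≤ (3 - c) * GGcrit l) :
    IndependentStrandsJoin :=
  independentStrandsJoin_iff_tetraMergingEventually.2 (tetraMergingEventually_of_rectDominance h)

end Summit.CriticalPhenomena.Ising3DConformalLimit.Cruxes.IndependentStrandsJoin.PinchToTetra

/-! ## The registered sub-goal `stub_eventuallyUpgrade` -/

namespace Summit.CriticalPhenomena.Ising3DConformalLimit.Theorems

open Summit.CriticalPhenomena.Ising3DConformalLimit.Cruxes.IndependentStrandsJoin.PinchToTetra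

/-- **Registered sub-goal `stub_eventuallyUpgrade` of the crux `IndependentStrandsJoin`** (stmt-CriticalPhenomena-14625, line
`pinch-to-tetra` r7): tetrahedral far merging at all large scales and the per-scale crux imply the crux BY NAME, with no
scaling-limit hypothesis (`PinchToTetra.independentStrandsJoin_of_eventually`). -/
theorem stub_eventuallyUpgrade : TetraMergingEventually → IndependentStrandsJoinPerScale → IndependentStrandsJoin :=
  independentStrandsJoin_of_eventually

end Summit.CriticalPhenomena.Ising3DConformalLimit.Theorems

/-! ## Appendix (lead c7-0, same day): the ALL-SCALES form — the planner-facing restatement of the crux -/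

namespace Summit.CriticalPhenomena.Ising3DConformalLimit.Cruxes.IndependentStrandsJoin.PinchToTetra

/-- **The crux IS `inf_{l ≥ 1} R₄(A_l) > 0`** — the all-scales form, with no threshold scale: `IndependentStrandsJoin ↔
∃ c > 0, ∀ l ≥ 1, c ≤ R₄(A_l)`.  (→: the closed sandwich gives the tetrahedral bound at every scale `l ≥ 1`;
←: the eventual form `independentStrandsJoin_iff_R4ratio` with `l₁ = 1`.)  This is the statement a planner may file in
place of the loop-O(1) dress: Aizenman's merging ratio of the regular lattice tetrahedra of `ℤ³` at `β_c` is bounded below,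
uniformly in the (even) cube side `2l`. [folklore] -/
theorem independentStrandsJoin_iff_forall_R4ratio :
    IndependentStrandsJoin ↔ ∃ c : ℝ, 0 < c ∧ ∀ l : ℕ, 1 ≤ l → c ≤ R4ratio l := by
  constructor
  · intro h
    obtain ⟨c, hc, hall⟩ :=
      Summit.CriticalPhenomena.Ising3DConformalLimit.FKParityRobustnessLatticeBoundFromStrands.latticeBoundFromStrands_proof
        h Summit.CriticalPhenomena.Ising3DConformalLimit.FKParityRobustnessStrandsJoinBound.strandsJoinBound_proof
    refine ⟨c, hc, fun l hl => ?_⟩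
    have hb : U4crit l ≤ -(c * GGcrit l) := by
      simpa [U4crit, GGcrit, tetra] using hall l hl
    have hG : 0 < GGcrit l := GGcrit_pos l
    rw [R4ratio, le_div_iff₀ hG]
    linarith
  · rintro ⟨c, hc, h⟩
    exact independentStrandsJoin_iff_R4ratio.2 ⟨c, hc, 1, h⟩

end Summit.CriticalPhenomena.Ising3DConformalLimit.Cruxes.IndependentStrandsJoin.PinchToTetra

end
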